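import Literature.AlgebraicGeometry.Resolution.ValuationConjugation
import Mathlib.FieldTheory.PurelyInseparable.Basic
import HarnessLib

/-!
# Conjugacy of the extensions of a valuation to a normal extension; purely inseparable uniqueness

Topic: `Literature/AlgebraicGeometry/Resolution` (valued function fields). PROVED complements
to the conjugation theorem of `ValuationConjugation.lean` (Bourbaki, *Alg. Comm.* VI §8 no. 6,
Prop. 7, Cor. 1; F.-V. Kuhlmann, *Elimination of ramification I*, Trans. AMS 362 (2010) =
arXiv:1003.5678, §1.1: "all extensions of the valuation `v` from `K` to `K^sep` are
conjugate"), needed for the henselization `K^h ⊆ K^sep ⊆ K̃` of `Henselization.lean`, whose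
finite extensions are NOT all inside `K^sep`: the passage from the separable closure `K^sep`
to the algebraic closure `K̃` (a purely inseparable extension, through which valuations extend
uniquely), i.e. Bourbaki's Cor. 1 in its printed generality of a quasi-Galois (normal)
extension.

## Content (everything PROVED)

* `mem_smul_valuationSubring_iff`, `valuation_smul_le_iff`, `valuation_smul_lt_iff`,
  `valuation_algEquiv_apply_lt_one_iff`, `valuation_prod_lt_one` — bookkeeping for `σ • W`.
* `valuationSubring_mem_iff_pow_mem`, `valuationSubring_eq_of_isPurelyInseparable` — through a
  PURELY INSEPARABLE extension a valuation ring extends in at most one way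
  (`x ∈ W ↔ x^{p^n} ∈ W`). [folklore]
* `exists_finiteDimensional_normal_mem` — an element of a normal extension lies in a finite
  normal subextension (splitting field of its minimal polynomial). [folklore]
* `exists_smul_eq_of_normal` — **conjugacy for a normal algebraic extension** `L/K`: valuation
  rings `W₁, W₂` of `L` with `W₁ ∩ K = W₂ ∩ K` satisfy `W₂ = σ(W₁)` for some `σ ∈ Aut(L/K)`
  (conjugate inside the separable closure of `K` in `L` by `exists_smul_eq_of_isGalois`, lift
  by `AlgEquiv.liftNormal`, conclude by purely inseparable uniqueness).

## Sources

* N. Bourbaki, *Algèbre commutative* Ch. VI §8 no. 6, Prop. 7, Cor. 1 ("`L` une extension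
  quasi-galoisienne de `K`").
* F.-V. Kuhlmann, Trans. AMS 362 (2010) = arXiv:1003.5678, §1.1 (p. 3).
-/

noncomputable section

open scoped Pointwise

namespace Literature.AlgebraicGeometry.Resolution

universe u

/-! ### Transport of a valuation ring along an automorphism -/

section Transport

variable {K L : Type*} [Field K] [Field L] [Algebra K L]

/-- `x ∈ σ • W ↔ σ⁻¹ x ∈ W`. [folklore] -/
theorem mem_smul_valuationSubring_iff (σ : L ≃ₐ[K] L) (W : ValuationSubring L) (x : L) :
    x ∈ σ • W ↔ σ.symm x ∈ W := by
  rw [ValuationSubring.mem_pointwise_smul_iff_inv_smul_mem, AlgEquiv.smul_def, AlgEquiv.aut_inv]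

/-- `σ x ∈ σ • W ↔ x ∈ W`. [folklore] -/
theorem apply_mem_smul_valuationSubring_iff (σ : L ≃ₐ[K] L) (W : ValuationSubring L) (x : L) :
    σ x ∈ σ • W ↔ x ∈ W := by
  rw [mem_smul_valuationSubring_iff, AlgEquiv.symm_apply_apply]

/-- The valuation of `σ • W` is the valuation of `W` composed with `σ⁻¹` (inequalities).
[folklore] -/
theorem valuation_smul_le_iff (σ : L ≃ₐ[K] L) (W : ValuationSubring L) (x y : L) :
    (σ • W).valuation x ≤ (σ • W).valuation y ↔
      W.valuation (σ.symm x) ≤ W.valuation (σ.symm y) := by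
  rw [ValuationSubring.valuation_le_iff, ValuationSubring.valuation_le_iff]
  constructor
  · rintro ⟨a, ha⟩
    refine ⟨⟨σ.symm a, (mem_smul_valuationSubring_iff σ W a).mp a.2⟩, ?_⟩
    simp only [← ha, map_mul]
  · rintro ⟨b, hb⟩
    refine ⟨⟨σ b, (apply_mem_smul_valuationSubring_iff σ W b).mpr b.2⟩, ?_⟩
    apply σ.symm.injective
    simp only [map_mul, AlgEquiv.symm_apply_apply, hb]

/-- The valuation of `σ • W` is the valuation of `W` composed with `σ⁻¹` (strict inequalities).
[folklore] -/
theorem valuation_smul_lt_iff (σ : L ≃ₐ[K] L) (W : ValuationSubring L) (x y : L) :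
    (σ • W).valuation x < (σ • W).valuation y ↔
      W.valuation (σ.symm x) < W.valuation (σ.symm y) := by
  rw [lt_iff_not_ge, lt_iff_not_ge, valuation_smul_le_iff]

/-- `|x|_{σW} ≤ |y|_{σW} ↔ |σ⁻¹x|_W ≤ |σ⁻¹y|_W`, version with `σ` applied. [folklore] -/
theorem valuation_algEquiv_apply_lt_one_iff (σ : L ≃ₐ[K] L) (W : ValuationSubring L) (x : L) :
    W.valuation (σ x) < 1 ↔ (σ⁻¹ • W).valuation x < 1 := by
  rw [valuation_smul_lt_one_iff, inv_inv, AlgEquiv.smul_def]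

end Transport

/-! ### Purely inseparable extensions: uniqueness of the extension -/

section PurelyInseparable

variable {S E : Type*} [Field S] [Field E] [Algebra S E]

/-- In a valuation ring, `x ∈ W ↔ x ^ m ∈ W` for `m ≠ 0`. [folklore] -/
theorem valuationSubring_mem_iff_pow_mem (W : ValuationSubring E) {m : ℕ} (hm : m ≠ 0) (x : E) :
    x ∈ W ↔ x ^ m ∈ W := by
  refine ⟨fun h => pow_mem h m, fun h => ?_⟩
  by_contra hx
  have h1 : 1 < W.valuation x := lt_of_not_ge fun hle => hx ((W.valuation_le_one_iff x).mp hle)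
  have h2 : W.valuation (x ^ m) ≤ 1 := (W.valuation_le_one_iff _).mpr h
  rw [map_pow] at h2
  exact (one_lt_pow₀ h1 hm).not_ge h2

/-- **Through a purely inseparable extension `E/S` a valuation ring of `S` has at most one
extension**: two valuation rings of `E` inducing the same valuation ring of `S` coincide
(`x ∈ W ↔ x^{p^n} ∈ W` and `x^{p^n} ∈ S`). PROVED. [folklore] -/
theorem valuationSubring_eq_of_isPurelyInseparable [IsPurelyInseparable S E]
    (W₁ W₂ : ValuationSubring E)
    (h : W₁.comap (algebraMap S E) = W₂.comap (algebraMap S E)) : W₁ = W₂ := by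
  obtain ⟨q, hq⟩ := ExpChar.exists S
  ext x
  obtain ⟨n, y, hy⟩ := IsPurelyInseparable.pow_mem S q x
  have hqn : q ^ n ≠ 0 := pow_ne_zero n (expChar_pos S q).ne'
  rw [valuationSubring_mem_iff_pow_mem W₁ hqn, valuationSubring_mem_iff_pow_mem W₂ hqn, ← hy]
  change y ∈ W₁.comap (algebraMap S E) ↔ y ∈ W₂.comap (algebraMap S E)
  rw [h]

end PurelyInseparable

/-! ### Normal algebraic extensions -/

section NormalTools

variable (K : Type u) {L : Type u} [Field K] [Field L] [Algebra K L]

/-- A product of elements of `𝔪_W` over a non-empty finite set lies in `𝔪_W`. [folklore] -/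
theorem valuation_prod_lt_one (W : ValuationSubring L) {ι : Type*} {s : Finset ι} (hs : s.Nonempty)
    (f : ι → L) (hf : ∀ i ∈ s, W.valuation (f i) < 1) :
    W.valuation (∏ i ∈ s, f i) < 1 := by
  classical
  obtain ⟨a, ha⟩ := hs
  rw [← Finset.mul_prod_erase s f ha, map_mul, map_prod]
  have hle : ∏ i ∈ s.erase a, W.valuation (f i) ≤ 1 :=
    Finset.prod_le_one' fun i hi => (hf i (Finset.mem_of_mem_erase hi)).le
  calc W.valuation (f a) * ∏ i ∈ s.erase a, W.valuation (f i)
      ≤ W.valuation (f a) * 1 := by gcongr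
    _ < 1 := by rw [mul_one]; exact hf a ha

/-- Every element of a normal extension lies in a finite normal subextension (the splitting
field of its minimal polynomial). [folklore] -/
theorem exists_finiteDimensional_normal_mem [Normal K L] (x : L) :
    ∃ E : IntermediateField K L, FiniteDimensional K E ∧ Normal K E ∧ x ∈ E := by
  have hsplit : ((minpoly K x).map (algebraMap K L)).Splits := Normal.splits inferInstance x
  haveI := IntermediateField.adjoin_rootSet_isSplittingField hsplit
  refine ⟨IntermediateField.adjoin K ((minpoly K x).rootSet L),
    Polynomial.IsSplittingField.finiteDimensional _ (minpoly K x),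
    Normal.of_isSplittingField (minpoly K x), ?_⟩
  apply IntermediateField.subset_adjoin
  rw [Polynomial.mem_rootSet]
  exact ⟨minpoly.ne_zero (Algebra.IsIntegral.isIntegral x), minpoly.aeval K x⟩

end NormalTools

section NormalExt

variable (K : Type u) {L : Type u} [Field K] [Field L] [Algebra K L]

/-- **Conjugacy of the extensions of a valuation in a normal algebraic extension**: for `L/K`
normal and valuation rings `W₁, W₂` of `L` with `W₁ ∩ K = W₂ ∩ K` there is `σ ∈ Aut(L/K)`
with `σ(W₁) = W₂`. PROVED: conjugate inside the separable closure `S` of `K` in `L` (Galois),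
lift the automorphism to `L` (normality), and use that `L/S` is purely inseparable, through
which valuation rings extend uniquely. [cite: BourbakiAC5to7, Ch. VI §8 no. 6, Prop. 7 Cor. 1] -/
theorem exists_smul_eq_of_normal [Normal K L] (W₁ W₂ : ValuationSubring L)
    (h : W₁.comap (algebraMap K L) = W₂.comap (algebraMap K L)) :
    ∃ σ : L ≃ₐ[K] L, σ • W₁ = W₂ := by
  let S : IntermediateField K L := separableClosure K L
  have hS : (W₁.comap (algebraMap S L)).comap (algebraMap K S) =
      (W₂.comap (algebraMap S L)).comap (algebraMap K S) := by
    rw [ValuationSubring.comap_comap, ValuationSubring.comap_comap,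
      ← IsScalarTower.algebraMap_eq, h]
  obtain ⟨σ₀, hσ₀⟩ := exists_smul_eq_of_isGalois K _ _ hS
  refine ⟨σ₀.liftNormal L, ?_⟩
  haveI : IsPurelyInseparable S L := separableClosure.isPurelyInseparable K L
  refine valuationSubring_eq_of_isPurelyInseparable (S := S) _ _ ?_
  rw [← hσ₀]
  ext x
  rw [ValuationSubring.mem_comap, mem_smul_valuationSubring_iff, mem_smul_valuationSubring_iff,
    ValuationSubring.mem_comap]
  have hcomm : (σ₀.liftNormal L).symm (algebraMap S L x) = algebraMap S L (σ₀.symm x) := by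
    rw [AlgEquiv.symm_apply_eq, AlgEquiv.liftNormal_commutes, AlgEquiv.apply_symm_apply]
  rw [hcomm]

end NormalExt

end Literature.AlgebraicGeometry.Resolution
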